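import Summits.Ventures.HodgeRepro2.T5SU11JacobiEvenMGF
import Mathlib.Analysis.Calculus.IteratedDeriv.Lemmas
import Mathlib.Analysis.Calculus.Deriv.ZPow

/-!
# All cumulants of the phase at the even parameters:
`κ_m(log|a|) = (m − 1)! · [1/(k − 2)^m + Σ_{i<n} (1/(k − 4 − 2i)^m − 1/(k + 2i)^m)]` under `m_k φ_{2n+2} dν/m̂_k(2n+2)`

Row 394 (`T5SU11JacobiEvenMGF.mgf_phase_even_eq`) gives the moment generating function of the phase `s = log|a(g)|`
at `λ = 2n + 2` as the rational function `E_{k,2n+2}[e^{−hs}] = ((k−2)/(k+h−2)) Π_{i<n} ((k+h+2i)(k−4−2i))/((k+2i)(k+h−4−2i))`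
for `k + h > 2n + 2`. Its logarithm — the CUMULANT GENERATING FUNCTION `cgfEven n k h` — agrees on the open set
`{h | k + h > 2n + 2}` (a neighbourhood of `h = 0` when `k > 2n + 2`) with the explicit sum of logarithms

  `cgfEvenExplicit n k h = const − log(h + (k − 2)) + Σ_{i<n} (log(h + (k + 2i)) − log(h + (k − 4 − 2i)))`
  (`cgfEven_eq`, `cgfEven_eventuallyEq`),

so its derivatives at `0` are those of the explicit function (`Filter.EventuallyEq.iteratedDeriv_eq`), and
`D^{m+1} log(h + d) = (−1)^m m! (h + d)^{−1−m}` (`iteratedDeriv_log_add`, from Mathlib's `iter_deriv_inv_linear`) gives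

  **`D^{m+1} cgfEven n k (0) = (−1)^{m+1} m! · [1/(k − 2)^{m+1} + Σ_{i<n} (1/(k − 4 − 2i)^{m+1} − 1/(k + 2i)^{m+1})]`**
  (`iteratedDeriv_cgfEven`).

Since `E[e^{−hs}]` is the MGF of `−s`, the `m`-th cumulant of the phase `s` itself is `(−1)^m` times this derivative
(`cumulantEven n k m := (−1)^m · D^m cgfEven n k (0)`):

  **`κ_{m+1}(s) = m! · cumProd n k (m + 1)`**, `cumProd n k m := 1/(k − 2)^m + Σ_{i<n} (1/(k − 4 − 2i)^m − 1/(k + 2i)^m)`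
  (`cumulantEven_succ_eq`),

with the cross-checks `cumProd n k 1 = meanProd n k` and `cumProd n k 2 = varProd n k` — row 381's mean and variance
of the phase (`cumProd_one`, `cumProd_two`, `cumulantEven_one`, `cumulantEven_two`). All cumulants of the phase at the
even parameters are therefore explicit finite sums of inverse powers of the rates `k − 2 − 2i` and `k + 2i`: the
phase is the sum of `n + 1` independent exponentials (rates `k − 2`, `k − 4 − 2i`) minus `n` independent exponentials
(rates `k + 2i`) in cumulant-generating-function terms. Nothing is claimed about (N).

Blind lane: Mathlib + the HodgeRepro2 prefix only; no sorry; axioms ⊆ {propext, Classical.choice,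
Quot.sound}.
-/

namespace Summit.Ventures.HodgeRepro2.T5SU11JacobiEvenCumulants

open MeasureTheory Metric Set Filter Topology Finset
open T5SU11Unimodular T5SU11Fibration T5SU11Cartan T5HaarCircle T5BergmanCoefficient T5SU11FibrationHaar
  T5SU11SphericalFunction T5SU11JacobiEvenProduct T5SU11JacobiPhaseMGF T5SU11JacobiEvenMGF
open scoped Real

/-! ### Iterated derivatives of `log (h + d)` -/

/-- **`D^{m+1} log(h + d) = (−1)^m m! (x + d)^{−1−m}`** at any `x` with `x + d > 0`. -/
theorem iteratedDeriv_log_add (d : ℝ) {x : ℝ} (hx : 0 < x + d) (m : ℕ) :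
    iteratedDeriv (m + 1) (fun h : ℝ => Real.log (h + d)) x
      = (-1) ^ m * (m.factorial : ℝ) * (x + d) ^ (-1 - m : ℤ) := by
  rw [iteratedDeriv_succ']
  have hev : deriv (fun h : ℝ => Real.log (h + d)) =ᶠ[𝓝 x] fun h => (1 * h + d)⁻¹ := by
    have hopen : IsOpen {h : ℝ | 0 < h + d} := isOpen_lt continuous_const (continuous_id.add continuous_const)
    filter_upwards [hopen.mem_nhds hx] with h hh
    have := ((hasDerivAt_id' h).add_const d).log (ne_of_gt hh)
    rw [this.deriv]
    simp
  rw [hev.iteratedDeriv_eq m, iteratedDeriv_eq_iterate, iter_deriv_inv_linear m 1 d]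
  simp

/-- `x^{−1−m} = 1/x^{m+1}`. -/
theorem zpow_neg_one_sub (x : ℝ) (m : ℕ) : x ^ (-1 - m : ℤ) = 1 / x ^ (m + 1) := by
  rw [show (-1 - m : ℤ) = -((m + 1 : ℕ) : ℤ) by push_cast; ring, zpow_neg, zpow_natCast, one_div]

/-- `h ↦ log (h + d)` is `C^n` at `x` when `x + d ≠ 0`. -/
theorem contDiffAt_log_add (d : ℝ) {x : ℝ} (hx : x + d ≠ 0) (n : ℕ) :
    ContDiffAt ℝ n (fun h : ℝ => Real.log (h + d)) x :=
  (contDiffAt_id.add contDiffAt_const).log hx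

/-! ### The cumulant generating function of the phase at `λ = 2n + 2` -/

section measure

variable [MeasurableSpace Circle] [BorelSpace Circle]

/-- **The cumulant generating function of the phase at `λ = 2n + 2`** (rate convention):
`cgfEven n k h = log E_{k,2n+2}[e^{−h·log|a|}]`. -/
noncomputable def cgfEven (n : ℕ) (k h : ℝ) : ℝ :=
  Real.log ((∫ g, Real.exp (-(h * Real.log ‖mat g 0 0‖))
      * ((1 - ‖orbit g‖ ^ 2) ^ (k / 2) * sph (2 * (n : ℝ) + 2) g) ∂(nu haarCircle))
    / ∫ g, (1 - ‖orbit g‖ ^ 2) ^ (k / 2) * sph (2 * (n : ℝ) + 2) g ∂(nu haarCircle))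

end measure

/-- **The explicit cumulant generating function**:
`const − log(h + (k − 2)) + Σ_{i<n} (log(h + (k + 2i)) − log(h + (k − 4 − 2i)))`. -/
noncomputable def cgfEvenExplicit (n : ℕ) (k h : ℝ) : ℝ :=
  (Real.log (k - 2) + ∑ i ∈ range n, (Real.log (k - 4 - 2 * i) - Real.log (k + 2 * i)))
    + (-Real.log (h + (k - 2)) + ∑ i ∈ range n, (Real.log (h + (k + 2 * i)) - Real.log (h + (k - 4 - 2 * i))))

/-- **The `m`-th cumulant sum** `cumProd n k m = 1/(k − 2)^m + Σ_{i<n} (1/(k − 4 − 2i)^m − 1/(k + 2i)^m)`. -/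
noncomputable def cumProd (n : ℕ) (k : ℝ) (m : ℕ) : ℝ :=
  1 / (k - 2) ^ m + ∑ i ∈ range n, (1 / (k - 4 - 2 * i) ^ m - 1 / (k + 2 * i) ^ m)

/-- `cumProd n k 1 = meanProd n k` (row 381's mean phase). -/
theorem cumProd_one (n : ℕ) (k : ℝ) : cumProd n k 1 = meanProd n k := by
  simp only [cumProd, meanProd, pow_one, one_div]

/-- `cumProd n k 2 = varProd n k` (row 381's variance of the phase). -/
theorem cumProd_two (n : ℕ) (k : ℝ) : cumProd n k 2 = varProd n k := by
  simp only [cumProd, varProd, one_div]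

/-- **The cumulants are positive** for `k > 2n + 2`: every `cumProd n k (m + 1) > 0` (each bracket
`1/(k − 4 − 2i)^{m+1} − 1/(k + 2i)^{m+1}` is positive since `k − 4 − 2i < k + 2i`), hence `κ_{m+1} > 0`. -/
theorem cumProd_succ_pos (n : ℕ) {k : ℝ} (hk : 2 * (n : ℝ) + 2 < k) (m : ℕ) : 0 < cumProd n k (m + 1) := by
  have hn := fun i (hi : i ∈ range n) => factor_pos hk hi
  have h2 : (0 : ℝ) < k - 2 := by linarith
  refine add_pos_of_pos_of_nonneg (by positivity) (Finset.sum_nonneg fun i hi => ?_)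
  have ha := (hn i hi).1
  have hb := (hn i hi).2
  have hlt : k - 4 - 2 * (i : ℝ) < k + 2 * i := by linarith [(Nat.cast_nonneg i : (0 : ℝ) ≤ i)]
  have hpow : (k - 4 - 2 * (i : ℝ)) ^ (m + 1) ≤ (k + 2 * i) ^ (m + 1) := pow_le_pow_left₀ hb.le hlt.le _
  have hpos : 0 < (k - 4 - 2 * (i : ℝ)) ^ (m + 1) := pow_pos hb _
  rw [sub_nonneg]
  exact one_div_le_one_div_of_le hpos hpow

section measure

variable [MeasurableSpace Circle] [BorelSpace Circle]

/-- **`cgfEven = cgfEvenExplicit`** for `k > 2n + 2`, `k + h > 2n + 2` (the logarithm of row 394). -/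
theorem cgfEven_eq (n : ℕ) {k h : ℝ} (hk : 2 * (n : ℝ) + 2 < k) (hkh : 2 * (n : ℝ) + 2 < k + h) :
    cgfEven n k h = cgfEvenExplicit n k h := by
  have hn := fun i (hi : i ∈ range n) => factor_pos hk hi
  have hn' := fun i (hi : i ∈ range n) => factor_pos hkh hi
  have h2 : k - 2 ≠ 0 := by intro h0; linarith
  have h2' : k + h - 2 ≠ 0 := by intro h0; linarith
  have hf : ∀ i ∈ range n, ((k + h + 2 * i) * (k - 4 - 2 * i)) / ((k + 2 * i) * (k + h - 4 - 2 * i)) ≠ 0 :=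
    fun i hi => div_ne_zero (mul_ne_zero (hn' i hi).1.ne' (hn i hi).2.ne')
      (mul_ne_zero (hn i hi).1.ne' (hn' i hi).2.ne')
  rw [cgfEven, mgf_phase_even_eq n hk hkh, cgfEvenExplicit,
    Real.log_mul (div_ne_zero h2 h2') (Finset.prod_ne_zero_iff.mpr hf), Real.log_div h2 h2', Real.log_prod hf]
  have e : ∀ i ∈ range n, Real.log (((k + h + 2 * i) * (k - 4 - 2 * i)) / ((k + 2 * i) * (k + h - 4 - 2 * i)))
      = (Real.log (k - 4 - 2 * i) - Real.log (k + 2 * i))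
        + (Real.log (h + (k + 2 * i)) - Real.log (h + (k - 4 - 2 * i))) := by
    intro i hi
    rw [Real.log_div (mul_ne_zero (hn' i hi).1.ne' (hn i hi).2.ne') (mul_ne_zero (hn i hi).1.ne' (hn' i hi).2.ne'),
      Real.log_mul (hn' i hi).1.ne' (hn i hi).2.ne', Real.log_mul (hn i hi).1.ne' (hn' i hi).2.ne',
      show k + h + 2 * (i : ℝ) = h + (k + 2 * i) by ring, show k + h - 4 - 2 * (i : ℝ) = h + (k - 4 - 2 * i) by ring]
    ring
  rw [Finset.sum_congr rfl e, Finset.sum_add_distrib, show k + h - 2 = h + (k - 2) by ring]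
  ring

/-- **`cgfEven n k` agrees with the explicit function near `h = 0`** for `k > 2n + 2`. -/
theorem cgfEven_eventuallyEq (n : ℕ) {k : ℝ} (hk : 2 * (n : ℝ) + 2 < k) :
    cgfEven n k =ᶠ[𝓝 0] cgfEvenExplicit n k := by
  have hopen : IsOpen {h : ℝ | 2 * (n : ℝ) + 2 < k + h} :=
    isOpen_lt continuous_const (continuous_const.add continuous_id)
  filter_upwards [hopen.mem_nhds (by simpa using hk)] with h hh
  exact cgfEven_eq n hk hh

end measure

/-! ### The derivatives of the explicit cumulant generating function at `0` -/

/-- **`D^{m+1} cgfEvenExplicit n k (0) = (−1)^{m+1} m! · cumProd n k (m + 1)`** for `k > 2n + 2`. -/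
theorem iteratedDeriv_cgfEvenExplicit (n : ℕ) {k : ℝ} (hk : 2 * (n : ℝ) + 2 < k) (m : ℕ) :
    iteratedDeriv (m + 1) (cgfEvenExplicit n k) 0 = (-1) ^ (m + 1) * (m.factorial : ℝ) * cumProd n k (m + 1) := by
  have hn := fun i (hi : i ∈ range n) => factor_pos hk hi
  have h2 : (0 : ℝ) < 0 + (k - 2) := by linarith
  have hp : ∀ i ∈ range n, (0 : ℝ) < 0 + (k + 2 * i) := fun i hi => by linarith [(hn i hi).1]
  have hq : ∀ i ∈ range n, (0 : ℝ) < 0 + (k - 4 - 2 * i) := fun i hi => by linarith [(hn i hi).2]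
  have c1 : ContDiffAt ℝ (m + 1 : ℕ) (fun h : ℝ => Real.log (h + (k - 2))) 0 := contDiffAt_log_add _ h2.ne' _
  have c2 : ∀ i ∈ range n, ContDiffAt ℝ (m + 1 : ℕ) (fun h : ℝ => Real.log (h + (k + 2 * i))) 0 :=
    fun i hi => contDiffAt_log_add _ (hp i hi).ne' _
  have c3 : ∀ i ∈ range n, ContDiffAt ℝ (m + 1 : ℕ) (fun h : ℝ => Real.log (h + (k - 4 - 2 * i))) 0 :=
    fun i hi => contDiffAt_log_add _ (hq i hi).ne' _
  have cS : ContDiffAt ℝ (m + 1 : ℕ)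
      (fun h : ℝ => ∑ i ∈ range n, (Real.log (h + (k + 2 * i)) - Real.log (h + (k - 4 - 2 * i)))) 0 :=
    ContDiffAt.sum fun i hi => (c2 i hi).sub (c3 i hi)
  unfold cgfEvenExplicit
  rw [iteratedDeriv_const_add (Nat.succ_pos m), iteratedDeriv_fun_add c1.neg cS, iteratedDeriv_fun_neg,
    iteratedDeriv_fun_sum fun i hi => (c2 i hi).sub (c3 i hi), iteratedDeriv_log_add _ h2 m]
  rw [Finset.sum_congr rfl fun i hi => by
    rw [iteratedDeriv_fun_sub (c2 i hi) (c3 i hi), iteratedDeriv_log_add _ (hp i hi) m,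
      iteratedDeriv_log_add _ (hq i hi) m]]
  simp only [zero_add, zpow_neg_one_sub, cumProd]
  rw [mul_add, Finset.mul_sum]
  congr 1
  · ring
  · exact Finset.sum_congr rfl fun i _ => by ring

section measure

variable [MeasurableSpace Circle] [BorelSpace Circle]

/-- **THE DERIVATIVES OF THE CUMULANT GENERATING FUNCTION AT `0`**, for `k > 2n + 2`:
`D^{m+1} cgfEven n k (0) = (−1)^{m+1} m! · [1/(k − 2)^{m+1} + Σ_{i<n} (1/(k − 4 − 2i)^{m+1} − 1/(k + 2i)^{m+1})]`. -/
theorem iteratedDeriv_cgfEven (n : ℕ) {k : ℝ} (hk : 2 * (n : ℝ) + 2 < k) (m : ℕ) :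
    iteratedDeriv (m + 1) (cgfEven n k) 0 = (-1) ^ (m + 1) * (m.factorial : ℝ) * cumProd n k (m + 1) := by
  rw [(cgfEven_eventuallyEq n hk).iteratedDeriv_eq (m + 1), iteratedDeriv_cgfEvenExplicit n hk m]

/-- **The `m`-th cumulant of the phase `s = log|a|`** under `m_k φ_{2n+2} dν/m̂_k(2n+2)`: `(−1)^m D^m cgfEven n k (0)`
(the sign because `E[e^{−hs}]` is the MGF of `−s`). -/
noncomputable def cumulantEven (n : ℕ) (k : ℝ) (m : ℕ) : ℝ := (-1) ^ m * iteratedDeriv m (cgfEven n k) 0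

/-- **ALL CUMULANTS OF THE PHASE AT `λ = 2n + 2`**: `κ_{m+1} = m! · [1/(k − 2)^{m+1} + Σ_{i<n} (1/(k − 4 − 2i)^{m+1} − 1/(k + 2i)^{m+1})]`
for `k > 2n + 2`. -/
theorem cumulantEven_succ_eq (n : ℕ) {k : ℝ} (hk : 2 * (n : ℝ) + 2 < k) (m : ℕ) :
    cumulantEven n k (m + 1) = (m.factorial : ℝ) * cumProd n k (m + 1) := by
  rw [cumulantEven, iteratedDeriv_cgfEven n hk m, ← mul_assoc, ← mul_assoc, ← pow_add,
    show m + 1 + (m + 1) = 2 * (m + 1) by ring, pow_mul, neg_one_sq, one_pow, one_mul]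

/-- **`κ_1 = meanProd n k`**: the first cumulant is row 381's mean phase. -/
theorem cumulantEven_one (n : ℕ) {k : ℝ} (hk : 2 * (n : ℝ) + 2 < k) : cumulantEven n k 1 = meanProd n k := by
  rw [cumulantEven_succ_eq n hk 0, Nat.factorial_zero, Nat.cast_one, one_mul, cumProd_one]

/-- **`κ_2 = varProd n k`**: the second cumulant is row 381's variance of the phase. -/
theorem cumulantEven_two (n : ℕ) {k : ℝ} (hk : 2 * (n : ℝ) + 2 < k) : cumulantEven n k 2 = varProd n k := by
  rw [cumulantEven_succ_eq n hk 1, Nat.factorial_one, Nat.cast_one, one_mul, cumProd_two]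

/-- **`κ_{m+1} > 0`** for `k > 2n + 2`. -/
theorem cumulantEven_succ_pos (n : ℕ) {k : ℝ} (hk : 2 * (n : ℝ) + 2 < k) (m : ℕ) : 0 < cumulantEven n k (m + 1) := by
  rw [cumulantEven_succ_eq n hk m]
  exact mul_pos (by exact_mod_cast m.factorial_pos) (cumProd_succ_pos n hk m)

end measure

end Summit.Ventures.HodgeRepro2.T5SU11JacobiEvenCumulants
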